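import Literature.NumberTheory.Sieve.RoughOmegaCells
import Literature.NumberTheory.LFunctions.PrimeSumStandardWeights
import HarnessLib

/-!
# Ω-cells of the rough integers in residue classes: recursion, base case and Buchstab step

Topic `Literature/NumberTheory/Sieve`. Everything here is PROVED (no definitions, no named facts).
For a modulus `q ≥ 1`, a reduced residue `c`, and the `Ω`-cells of the `N`-rough numbers
`roughIcc N X = {1 ≤ b ≤ X : p ∣ b ⇒ p ≥ N}` we study the CLASS DISCREPANCY of a cell,

`D_j(X, Y; q, c) = #{b ∈ roughIcc ⌈Y⌉ ⌊X⌋ : Ω b = j, b ≡ c (q)} − #{b ∈ roughIcc ⌈Y⌉ ⌊X⌋ : Ω b = j}/φ(q)`,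

towards the equidistribution theorem of `RoughOmegaCellsClassesEquidistribution.lean`
(`D_j(X, Y; q, c) = O_{q,k}(X/log² Y)` uniformly for `q < Y ≤ X ≤ Y^k`, `(c, q) = 1`; the base range,
whose input is the prime number theorem for progressions `PrimesInProgressionsFixedModulus.lean`, and
the induction are there). This file records (sub-namespace `RoughCellsAP`):

* `card_filter_minFac_pred_eq` — the fibre of the least-prime-factor map with a predicate carried
  along (the bijection `b ↦ b/p` of `card_filter_minFac_eq`, `RoughNumbersBuchstabIdentity.lean`), and
  the resulting `Ω`-refined Buchstab identity in a residue class `card_filter_cell_class_eq_add_sum`: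
  `#{b ∈ roughIcc N X : Ω b = j+1, b ≡ c} = #{b ∈ roughIcc M X : Ω b = j+1, b ≡ c}`
  `   + ∑_{N ≤ p < M} #{m ∈ roughIcc p (X/p) : Ω m = j, p m ≡ c}` (`N ≤ M`);
* `abs_cellClassDisc_step_of` — the Buchstab step for the cells `Ω = j + 2`: if
  `|D_{i+1}(X, Y; q, c)| ≤ C X/log² Y` for all `i`, all reduced `c` and `log X ≤ n log Y` (`q < Y`),
  then for `y < z = x^{1/n}` the identity `D_{j+2}(x, y; c) = D_{j+2}(x, z; c) + ∑_{y ≤ p < z} D_{j+1}(x/p, p; p⁻¹ c)`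
  and `∑_{y ≤ p < z} 1/p = O(1)` give `|D_{j+2}(x, y; c)| ≤ C (4 + 8C₀) x/log² y` (all inequalities
  between the parameters supplied as hypotheses, as in `abs_card_roughIcc_sub_main_step_of`).

## References

* K. Alladi, *The distribution of ν(n) in the sieve of Eratosthenes*, Quart. J. Math. Oxford (2) 33
  (1982), 129–148 (the cells `Φ_j(x, y)`). [Alladi1982]
* G. Tenenbaum, *Introduction to analytic and probabilistic number theory*, 3rd ed., AMS GSM 163
  (2015), Ch. III.6 (Buchstab's identity). [Tenenbaum2015]
* G. Harman, *Prime-Detecting Sieves*, LMS Monographs 33 (2007), §1.4 (1.4.13).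
-/

open Finset Filter
open scoped Chebyshev ArithmeticFunction.Omega

noncomputable section

namespace Literature.NumberTheory.Sieve

namespace RoughCellsAP

/-! ### Buchstab's identity with a predicate -/

/-- The fibre of the least-prime-factor map over a prime `p ∈ [N, M)`, with a predicate `P` carried
along: `b ↦ b / p` is a bijection from `{b ∈ roughIcc N X ∖ roughIcc M X : minFac b = p, P b}` onto
`{m ∈ roughIcc p (X / p) : P (p m)}` with inverse `m ↦ p m` (the bijection of `card_filter_minFac_eq`,
`RoughNumbersBuchstabIdentity.lean`). [folklore] -/
theorem card_filter_minFac_pred_eq {N M X p : ℕ} (hp : p.Prime) (hNp : N ≤ p) (hpM : p < M)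
    (P : ℕ → Prop) [DecidablePred P] :
    #(((roughIcc N X \ roughIcc M X).filter P).filter (fun b => b.minFac = p)) =
      #((roughIcc p (X / p)).filter (fun m => P (p * m))) := by
  refine Finset.card_bij' (fun b _ => b / p) (fun m _ => p * m) ?_ ?_ ?_ ?_
  · -- `b / p ∈ {m ∈ roughIcc p (X / p) : P (p m)}`
    intro b hb
    rw [mem_filter, mem_filter] at hb
    obtain ⟨⟨hbs, hPb⟩, hbm⟩ := hb
    have hbN := (Finset.mem_sdiff.mp hbs).1
    rw [mem_roughIcc] at hbN
    have hpb : p ∣ b := hbm ▸ Nat.minFac_dvd b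
    rw [mem_filter, mem_roughIcc, Nat.mul_div_cancel' hpb]
    refine ⟨⟨⟨?_, Nat.div_le_div_right hbN.1.2⟩, fun r hr hrc => ?_⟩, hPb⟩
    · exact Nat.div_pos (Nat.le_of_dvd hbN.1.1 hpb) hp.pos
    · have hrb : r ∣ b := hrc.trans (Nat.div_dvd_of_dvd hpb)
      exact hbm ▸ Nat.minFac_le_of_dvd hr.two_le hrb
  · -- `p * m` lies in the fibre
    intro m hm
    rw [mem_filter, mem_roughIcc] at hm
    obtain ⟨⟨⟨hm1, hmX⟩, hmr⟩, hPm⟩ := hm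
    have hpm_fac : ∀ r : ℕ, r.Prime → r ∣ p * m → p ≤ r := by
      intro r hr hrpm
      rcases (Nat.Prime.dvd_mul hr).mp hrpm with h | h
      · exact ((Nat.prime_dvd_prime_iff_eq hr hp).mp h).ge
      · exact hmr r hr h
    have hmin : (p * m).minFac = p := by
      apply le_antisymm
      · exact Nat.minFac_le_of_dvd hp.two_le (dvd_mul_right p m)
      · have h1 : p * m ≠ 1 := by
          intro h; exact hp.one_lt.ne' (Nat.eq_one_of_mul_eq_one_right h)
        exact hpm_fac _ (Nat.minFac_prime h1) (Nat.minFac_dvd _)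
    rw [Finset.mem_filter, Finset.mem_filter, Finset.mem_sdiff, mem_roughIcc, mem_roughIcc]
    refine ⟨⟨⟨⟨⟨?_, ?_⟩, fun r hr hrpm => hNp.trans (hpm_fac r hr hrpm)⟩, ?_⟩, hPm⟩, hmin⟩
    · exact Nat.mul_pos hp.pos hm1
    · exact (Nat.mul_le_mul_left p hmX).trans (Nat.mul_div_le X p)
    · rintro ⟨-, hM⟩
      exact (hM p hp (dvd_mul_right p m)).not_gt hpM
  · -- left inverse
    intro b hb
    rw [mem_filter] at hb
    exact Nat.mul_div_cancel' (hb.2 ▸ Nat.minFac_dvd b)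
  · -- right inverse
    intro m _
    exact Nat.mul_div_cancel_left m hp.pos

/-- **Buchstab's identity for an `Ω`-cell in a residue class**: for `N ≤ M`,
`#{b ∈ roughIcc N X : Ω b = j+1, b ≡ c (q)} = #{b ∈ roughIcc M X : Ω b = j+1, b ≡ c (q)}`
`  + ∑_{p prime, N ≤ p < M} #{m ∈ roughIcc p (X/p) : Ω m = j, p m ≡ c (q)}`
(sorting `roughIcc N X ∖ roughIcc M X` by the least prime factor `p ∈ [N, M)` as in Buchstab's identity
`card_roughIcc_eq_card_add_sum`, with the predicate carried along; `Ω(p m) = Ω(m) + 1`).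
[folklore] -/
theorem card_filter_cell_class_eq_add_sum {N M : ℕ} (hNM : N ≤ M) (X j q c : ℕ) :
    #((roughIcc N X).filter (fun b => Ω b = j + 1 ∧ b ≡ c [MOD q])) =
      #((roughIcc M X).filter (fun b => Ω b = j + 1 ∧ b ≡ c [MOD q])) +
        ∑ p ∈ (Ico N M).filter Nat.Prime,
          #((roughIcc p (X / p)).filter (fun m => Ω m = j ∧ p * m ≡ c [MOD q])) := by
  -- Buchstab's identity with the predicate `P` carried along
  have key : ∀ (P : ℕ → Prop) [DecidablePred P], #((roughIcc N X).filter P) =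
      #((roughIcc M X).filter P) +
        ∑ p ∈ (Ico N M).filter Nat.Prime, #((roughIcc p (X / p)).filter (fun m => P (p * m))) := by
    intro P _
    have hsub : (roughIcc M X).filter P ⊆ (roughIcc N X).filter P :=
      filter_subset_filter _ (roughIcc_subset_of_le hNM X)
    have hsdiff : (roughIcc N X).filter P \ (roughIcc M X).filter P =
        (roughIcc N X \ roughIcc M X).filter P := by
      ext b
      simp only [Finset.mem_sdiff, Finset.mem_filter]
      tauto
    have hsd : #((roughIcc N X \ roughIcc M X).filter P) =
        ∑ p ∈ (Ico N M).filter Nat.Prime, #((roughIcc p (X / p)).filter (fun m => P (p * m))) := by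
      rw [card_eq_sum_card_fiberwise (f := Nat.minFac) (t := (Ico N M).filter Nat.Prime)]
      · refine sum_congr rfl fun p hp => ?_
        rw [mem_filter, mem_Ico] at hp
        exact card_filter_minFac_pred_eq hp.2 hp.1.1 hp.1.2 P
      · intro b hb
        obtain ⟨-, hpr, hN, hM⟩ := minFac_mem_of_mem_sdiff (mem_filter.mp hb).1
        exact mem_filter.mpr ⟨mem_Ico.mpr ⟨hN, hM⟩, hpr⟩
    rw [← hsd, ← hsdiff, ← card_union_of_disjoint disjoint_sdiff, union_sdiff_of_subset hsub]
  rw [key (fun b => Ω b = j + 1 ∧ b ≡ c [MOD q])]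
  congr 1
  refine sum_congr rfl fun p hp => ?_
  rw [mem_filter] at hp
  congr 1
  refine filter_congr fun m hm => ?_
  have hm0 : m ≠ 0 := Nat.one_le_iff_ne_zero.mp (mem_roughIcc.mp hm).1.1
  rw [ArithmeticFunction.cardFactors_mul hp.2.ne_zero hm0,
    ArithmeticFunction.cardFactors_apply_prime hp.2]
  constructor
  · rintro ⟨h1, h2⟩
    exact ⟨by omega, h2⟩
  · rintro ⟨h1, h2⟩
    exact ⟨by omega, h2⟩

/-! ### The Buchstab step for the cells `Ω = j + 2` -/

/-- **The Buchstab step for the class discrepancy of the cells `Ω = j + 2`** (all inequalities between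
the parameters `y < z = x^{1/n}`, `a = ⌈y⌉ − 1`, `b = ⌈z⌉ − 1` supplied as hypotheses, as in
`RoughAP.abs_card_filter_sub_le_step_of`). If `|D_{i+1}(X, Y; q, c)| ≤ C X/log² Y` for all `i`, all
reduced `c` and all `2 ≤ Y ≤ X` with `log X ≤ n log Y`, `q < Y`, then the `Ω`-refined Buchstab
identities for the class cell and for the cell (`card_filter_cell_class_eq_add_sum`,
`card_filter_cell_eq_add_sum`) give
`D_{j+2}(x, y; c) = D_{j+2}(x, z; c) + ∑_{y ≤ p < z} D_{j+1}(x/p, p; d_p)`, `p d_p ≡ c (q)`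
(`p > q` is a unit mod `q`, and `d_p = p⁻¹ c` is again reduced), whence
`|D_{j+2}(x, y; c)| ≤ C (1 + ∑_{y ≤ p < z} 1/p) x/log² y ≤ C (4 + 8C₀) x/log² y`
(`sum_primes_Ioc_inv_le`). [folklore] -/
theorem abs_cellClassDisc_step_of {q : ℕ} (hq : 0 < q) {n : ℕ} {C C₀ : ℝ}
    (hC : 0 ≤ C) (hC₀ : 0 ≤ C₀) (hE : ∀ t : ℝ, 2 ≤ t → |θ t - t| ≤ C₀ * t / Real.log t ^ 2)
    (hP : ∀ X Y : ℝ, 2 ≤ Y → Y ≤ X → Real.log X ≤ n * Real.log Y → (q : ℝ) < Y →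
      ∀ i c : ℕ, c.Coprime q →
        |(#((roughIcc ⌈Y⌉₊ ⌊X⌋₊).filter (fun b => Ω b = i + 1 ∧ b ≡ c [MOD q])) : ℝ) -
            (#((roughIcc ⌈Y⌉₊ ⌊X⌋₊).filter (fun b => Ω b = i + 1)) : ℝ) / Nat.totient q| ≤
          C * X / Real.log Y ^ 2)
    {X Y z a b : ℝ} {N M : ℕ} (hNdef : ⌈Y⌉₊ = N) (hMdef : ⌈z⌉₊ = M) (hNM : N ≤ M)
    (hS : (Finset.Ico N M).filter Nat.Prime = (Finset.Ioc ⌊a⌋₊ ⌊b⌋₊).filter Nat.Prime)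
    (hx0 : 0 < X) (hY2 : 2 ≤ Y) (hqY : (q : ℝ) < Y)
    (hz2 : 2 ≤ z) (hzx : z ≤ X) (hzz : z * z ≤ X) (hyz : Y < z)
    (hxz : Real.log X ≤ n * Real.log z) (hXY : Real.log X ≤ (n + 1) * Real.log Y)
    (hea : Real.exp 1 ≤ a) (hab : a ≤ b) (hlb : Real.log b ≤ 3 * Real.log a)
    (hpS : ∀ p ∈ (Finset.Ioc ⌊a⌋₊ ⌊b⌋₊).filter Nat.Prime, p.Prime ∧ Y ≤ (p : ℝ) ∧ (p : ℝ) < z)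
    (j : ℕ) {c : ℕ} (hc : c.Coprime q) :
    |(#((roughIcc ⌈Y⌉₊ ⌊X⌋₊).filter (fun b => Ω b = j + 1 + 1 ∧ b ≡ c [MOD q])) : ℝ) -
        (#((roughIcc ⌈Y⌉₊ ⌊X⌋₊).filter (fun b => Ω b = j + 1 + 1)) : ℝ) / Nat.totient q| ≤
      C * (1 + ((1 + 2 * C₀) * 3 + 2 * C₀)) * X / Real.log Y ^ 2 := by
  have hy0 : 0 < Y := by linarith
  have hly : 0 < Real.log Y := Real.log_pos (by linarith)
  have hz0 : 0 < z := by linarith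
  have hlz : Real.log Y < Real.log z := Real.log_lt_log hy0 hyz
  have ha0 : 0 < a := (Real.exp_pos 1).trans_le hea
  have hla : 1 ≤ Real.log a := by rw [Real.le_log_iff_exp_le ha0]; exact hea
  have hφ0 : (0 : ℝ) < Nat.totient q := by exact_mod_cast Nat.totient_pos.mpr hq
  set S := (Finset.Ioc ⌊a⌋₊ ⌊b⌋₊).filter Nat.Prime with hS_def
  set XX := ⌊X⌋₊ with hXX
  -- Buchstab's identities for the class cell and for the cell
  have hBA := card_filter_cell_class_eq_add_sum hNM XX (j + 1) q c
  have hBB := card_roughIcc_filter_cardFactors_eq_add_sum hNM XX (j + 1)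
  rw [hS] at hBA hBB
  have hmain :
      (#((roughIcc N XX).filter (fun b => Ω b = j + 1 + 1 ∧ b ≡ c [MOD q])) : ℝ) -
        (#((roughIcc N XX).filter (fun b => Ω b = j + 1 + 1)) : ℝ) / Nat.totient q =
      ((#((roughIcc M XX).filter (fun b => Ω b = j + 1 + 1 ∧ b ≡ c [MOD q])) : ℝ) -
        (#((roughIcc M XX).filter (fun b => Ω b = j + 1 + 1)) : ℝ) / Nat.totient q) +
      ∑ p ∈ S, ((#((roughIcc p (XX / p)).filter (fun m => Ω m = j + 1 ∧ p * m ≡ c [MOD q])) : ℝ) -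
        (#((roughIcc p (XX / p)).filter (fun m => Ω m = j + 1)) : ℝ) / Nat.totient q) := by
    rw [hBA, hBB]
    push_cast
    rw [Finset.sum_sub_distrib, ← Finset.sum_div]
    ring
  -- the term at `(X, z)`
  set U : ℝ := C * X / Real.log Y ^ 2 with hU
  have hU0 : 0 ≤ U := by positivity
  have hA : |(#((roughIcc M XX).filter (fun b => Ω b = j + 1 + 1 ∧ b ≡ c [MOD q])) : ℝ) -
      (#((roughIcc M XX).filter (fun b => Ω b = j + 1 + 1)) : ℝ) / Nat.totient q| ≤ U := by
    have h := hP X z hz2 hzx hxz (hqY.trans hyz) (j + 1) c hc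
    rw [hMdef] at h
    refine h.trans ?_
    rw [hU, mul_div_assoc, mul_div_assoc]
    exact mul_le_mul_of_nonneg_left (div_le_div_of_nonneg_left hx0.le (by positivity)
      (pow_le_pow_left₀ hly.le hlz.le 2)) hC
  -- the terms at `(X / p, p)`
  have hterm : ∀ p ∈ S,
      |((#((roughIcc p (XX / p)).filter (fun m => Ω m = j + 1 ∧ p * m ≡ c [MOD q])) : ℝ) -
        (#((roughIcc p (XX / p)).filter (fun m => Ω m = j + 1)) : ℝ) / Nat.totient q)| ≤
        U * (p : ℝ)⁻¹ := by
    intro p hp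
    obtain ⟨hpP, hYp, hpz⟩ := hpS p hp
    have hp2 : (2 : ℝ) ≤ p := by exact_mod_cast hpP.two_le
    have hp0 : (0 : ℝ) < p := by linarith
    have hqp : (q : ℝ) < p := hqY.trans_le hYp
    have hpq : p.Coprime q := Nat.coprime_of_lt_prime hq.ne' (by exact_mod_cast hqp) hpP
    -- transport of the class through the unit `p`: `p m ≡ c ↔ m ≡ d (mod q)`, `d = p⁻¹ c` reduced
    obtain ⟨d, hd, hiff⟩ : ∃ d : ℕ, d.Coprime q ∧ ∀ m : ℕ, p * m ≡ c [MOD q] ↔ m ≡ d [MOD q] := by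
      rcases Nat.lt_or_ge 1 q with hq1 | hq1
      · obtain ⟨e, -, he⟩ := Nat.exists_mul_mod_eq_one_of_coprime hpq hq1
        have hpe : p * e ≡ 1 [MOD q] := by rw [Nat.ModEq, he, Nat.mod_eq_of_lt hq1]
        have hpd : p * (e * c) ≡ c [MOD q] := by simpa [mul_assoc] using hpe.mul_right c
        refine ⟨e * c, ?_, fun m => ⟨fun h => ?_, fun h => (h.mul_left p).trans hpd⟩⟩
        · have h1 : (p * (e * c)).Coprime q := by rw [Nat.Coprime, hpd.gcd_eq]; exact hc
          exact Nat.Coprime.coprime_mul_left h1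
        · exact Nat.ModEq.cancel_left_of_coprime (Nat.Coprime.gcd_eq_one hpq.symm)
            (h.trans hpd.symm)
      · have hq' : q = 1 := le_antisymm hq1 hq
        subst hq'
        exact ⟨0, Nat.coprime_one_right 0, fun m => ⟨fun _ => Nat.modEq_one, fun _ => Nat.modEq_one⟩⟩
    have hfc : (roughIcc p (XX / p)).filter (fun m => Ω m = j + 1 ∧ p * m ≡ c [MOD q]) =
        (roughIcc ⌈(p : ℝ)⌉₊ ⌊X / p⌋₊).filter (fun m => Ω m = j + 1 ∧ m ≡ d [MOD q]) := by
      rw [Nat.ceil_natCast, Nat.floor_div_natCast]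
      exact Finset.filter_congr fun m _ => by rw [hiff m]
    have hfc' : (roughIcc p (XX / p)).filter (fun m => Ω m = j + 1) =
        (roughIcc ⌈(p : ℝ)⌉₊ ⌊X / p⌋₊).filter (fun m => Ω m = j + 1) := by
      rw [Nat.ceil_natCast, Nat.floor_div_natCast]
    have hpp : (p : ℝ) ≤ X / p := by
      rw [le_div_iff₀ hp0]
      exact le_trans (mul_le_mul hpz.le hpz.le hp0.le hz0.le) hzz
    have hlyp : Real.log Y ≤ Real.log p := Real.log_le_log hy0 hYp
    have hlogp : 0 < Real.log p := hly.trans_le hlyp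
    have hlogXp : Real.log (X / p) ≤ n * Real.log p := by
      rw [Real.log_div hx0.ne' hp0.ne']
      have h2 : Real.log X ≤ (n + 1) * Real.log p := hXY.trans (by gcongr)
      linarith
    have h := hP (X / p) p hp2 hpp hlogXp hqp j d hd
    rw [← hfc, ← hfc'] at h
    refine h.trans ?_
    calc C * (X / p) / Real.log p ^ 2 = C * X / Real.log p ^ 2 * (p : ℝ)⁻¹ := by
          field_simp
      _ ≤ C * X / Real.log Y ^ 2 * (p : ℝ)⁻¹ := by gcongr
  -- `∑_{Y ≤ p < z} 1/p ≤ K₀`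
  have hsumK : ∑ p ∈ S, (p : ℝ)⁻¹ ≤ (1 + 2 * C₀) * 3 + 2 * C₀ := by
    have hratio : Real.log b / Real.log a ≤ 3 := by rw [div_le_iff₀ (by linarith)]; exact hlb
    calc ∑ p ∈ S, (p : ℝ)⁻¹ ≤ (1 + 2 * C₀) * (Real.log b / Real.log a) + 2 * C₀ :=
          Literature.NumberTheory.LFunctions.sum_primes_Ioc_inv_le hea hab hC₀ hE
      _ ≤ (1 + 2 * C₀) * 3 + 2 * C₀ := by gcongr
  -- assembly
  rw [hNdef, hmain]
  calc _ ≤ |(#((roughIcc M XX).filter (fun b => Ω b = j + 1 + 1 ∧ b ≡ c [MOD q])) : ℝ) -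
          (#((roughIcc M XX).filter (fun b => Ω b = j + 1 + 1)) : ℝ) / Nat.totient q| +
        |∑ p ∈ S, ((#((roughIcc p (XX / p)).filter (fun m => Ω m = j + 1 ∧ p * m ≡ c [MOD q])) : ℝ) -
          (#((roughIcc p (XX / p)).filter (fun m => Ω m = j + 1)) : ℝ) / Nat.totient q)| :=
        abs_add_le _ _
    _ ≤ U + ∑ p ∈ S, U * (p : ℝ)⁻¹ :=
        add_le_add hA ((Finset.abs_sum_le_sum_abs _ _).trans (Finset.sum_le_sum hterm))
    _ = U * (1 + ∑ p ∈ S, (p : ℝ)⁻¹) := by rw [← Finset.mul_sum]; ring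
    _ ≤ U * (1 + ((1 + 2 * C₀) * 3 + 2 * C₀)) := by gcongr
    _ = C * (1 + ((1 + 2 * C₀) * 3 + 2 * C₀)) * X / Real.log Y ^ 2 := by rw [hU]; ring

end RoughCellsAP

end Literature.NumberTheory.Sieve
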